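import Literature.Geometry.Riemannian.HeatKernelMeasures
import Mathlib.Probability.Kernel.Composition.IntegralCompProd
import Mathlib.Probability.Kernel.MeasurableIntegral
import HarnessLib

/-!
# Heat kernel measures against bounded measurable data
# (Bamler 2023, §3.1 Def. 3.2 (6)–(7): the reproduction formula and the a priori bounds for
# bounded Borel integrands)

Continuation of `HeatKernelMeasures.lean`. There the conjugate heat kernel measures
`ν_{x,t;s} = heatKernelMeasure hh hR t x s` of a smooth family `h` of Riemannian metrics on a
closed manifold `M` are constructed as probability measures, with the reproduction formula
(Bamler 2023, Def. 3.2 (7)) for CONTINUOUS test functions (`integral_heatKernelMeasure_trans`),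
on Borel sets and for `ℝ≥0∞`-valued integrands (`lintegral_heatKernelMeasure_trans`), and the
Chapman–Kolmogorov law of the Markov kernels `heatKernel hh hR t s` (`heatKernel_comp`).

The gradient property of a metric flow (Bamler 2023, Def. 3.2 (6)) and its consequences are
statements about `x ↦ ∫ φ dν_{x,t;s}` for BOUNDED MEASURABLE real-valued `φ` and Bochner
integrals. This file supplies the routine measure-theoretic facts for such data:

* `integrable_heatKernelMeasure_of_bounded` — bounded measurable `φ` is `ν_{x,t;s}`-integrable;
* `abs_integral_heatKernelMeasure_le` — `|∫ φ dν_{x,t;s}| ≤ B` if `|φ| ≤ B`;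
* `measurable_integral_heatKernelMeasure` — `x ↦ ∫ φ dν_{x,t;s}` is measurable for measurable
  `φ` (Bamler 2023, remark after Def. 3.2);
* `integral_heatKernelMeasure_trans_of_bounded` — the reproduction formula
  `∫ φ dν_{x,t;s} = ∫ (∫ φ dν_{y,r;s}) dν_{x,t;r}(y)`, `s ≤ r ≤ t`, for bounded measurable `φ`
  (from `heatKernel_comp` and `ProbabilityTheory.Kernel.integral_comp`);
* `integral_heatKernelMeasure_mem_Icc_of_bounded` — `a ≤ φ ≤ b` implies
  `a ≤ ∫ φ dν_{x,t;s} ≤ b`.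

What is NOT here: anything about the density `K(x,t;y,s)` or the gradient estimate itself.

## References

* R. H. Bamler, *Compactness theory of the space of super Ricci flows*, Invent. Math. 233 (2023),
  1121–1277, §3.1 Def. 3.2 and the remark following it. [Bamler2023]
* R. H. Bamler, *Entropy and heat kernel bounds on a Ricci flow background*, arXiv:2008.07093
  (2020), §2.3. [Bamler2020Entropy]
-/

noncomputable section

open Bundle Set Function Filter Manifold MeasureTheory Measure TopologicalSpace
open scoped Manifold ContDiff Topology ENNReal NNReal

namespace Literature.Geometry.Riemannian

open Lorentzian Lorentzian.PseudoRiemannianMetric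

section MeasurableData

variable {m : ℕ} {H : Type*} [TopologicalSpace H]
  {I : ModelWithCorners ℝ (EuclideanSpace ℝ (Fin m)) H} [I.Boundaryless]
  {M : Type*} [TopologicalSpace M] [ChartedSpace H M] [IsManifold I ∞ M]
  [T2Space M] [CompactSpace M] [SecondCountableTopology M] [MeasurableSpace M] [BorelSpace M]
  {h : ℝ → PseudoRiemannianMetric I ∞ (EuclideanSpace ℝ (Fin m)) (TangentSpace I : M → Type _)}
  (hh : IsContMDiffFamilyOn ∞ h univ) (hR : ∀ r, (h r).IsRiemannian)

/-- **Bounded measurable data is integrable** against every heat kernel measure `ν_{x,t;s}`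
(a probability measure on `M`). [folklore] -/
theorem integrable_heatKernelMeasure_of_bounded (t : ℝ) (x : M) (s : ℝ) {φ : M → ℝ}
    (hφm : Measurable φ) {B : ℝ} (hφb : ∀ y, |φ y| ≤ B) :
    Integrable φ (heatKernelMeasure hh hR t x s) :=
  Integrable.of_bound hφm.aestronglyMeasurable B
    (Eventually.of_forall fun y ↦ (Real.norm_eq_abs _).trans_le (hφb y))

/-- **`|∫ φ dν_{x,t;s}| ≤ B` whenever `|φ| ≤ B`** (the heat kernel measures have total mass one;
no measurability is needed since a non-integrable `φ` has integral `0 ≤ |φ x| ≤ B`). [folklore] -/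
theorem abs_integral_heatKernelMeasure_le (t : ℝ) (x : M) (s : ℝ) {φ : M → ℝ}
    {B : ℝ} (hφb : ∀ y, |φ y| ≤ B) :
    |∫ y, φ y ∂(heatKernelMeasure hh hR t x s)| ≤ B := by
  have hB := norm_integral_le_of_norm_le_const (μ := heatKernelMeasure hh hR t x s) (f := φ)
    (C := B) (Eventually.of_forall fun y ↦ (Real.norm_eq_abs _).trans_le (hφb y))
  rwa [probReal_univ, mul_one, Real.norm_eq_abs] at hB

/-- **Measurability of `x ↦ ∫ φ dν_{x,t;s}` for measurable `φ`** (Bamler 2023, remark after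
Def. 3.2: "the integrand `y ↦ ν_{y;t₁}(S)` is ... measurable"; here for a general measurable
real integrand, from the measurability of `x ↦ ν_{x,t;s}` as a Markov kernel and
`MeasureTheory.StronglyMeasurable.integral_kernel`). [cite: Bamler2023, §3.1, Def. 3.2] -/
theorem measurable_integral_heatKernelMeasure (t s : ℝ) {φ : M → ℝ} (hφm : Measurable φ) :
    Measurable fun x ↦ ∫ y, φ y ∂(heatKernelMeasure hh hR t x s) :=
  (hφm.stronglyMeasurable.integral_kernel (κ := heatKernel hh hR t s)).measurable

/-- **Reproduction formula for bounded measurable data** (Bamler 2023, Def. 3.2 (7) / Bamler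
2020a, §2.3, the semigroup property of the heat kernel): for `s ≤ r ≤ t` and bounded measurable
`φ`, `∫ φ dν_{x,t;s} = ∫ (∫ φ dν_{y,r;s}) dν_{x,t;r}(y)` (the Chapman–Kolmogorov law
`heatKernel_comp` integrated against `φ`, `ProbabilityTheory.Kernel.integral_comp`).
[cite: Bamler2023, §3.1, Def. 3.2] -/
theorem integral_heatKernelMeasure_trans_of_bounded {s r t : ℝ} (hsr : s ≤ r) (hrt : r ≤ t)
    (x : M) {φ : M → ℝ} (hφm : Measurable φ) {B : ℝ} (hφb : ∀ y, |φ y| ≤ B) :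
    ∫ y, φ y ∂(heatKernelMeasure hh hR t x s) =
      ∫ y, (∫ z, φ z ∂(heatKernelMeasure hh hR r y s)) ∂(heatKernelMeasure hh hR t x r) := by
  have hcomp := heatKernel_comp hh hR hsr hrt
  have hint : Integrable φ
      (ProbabilityTheory.Kernel.comp (heatKernel hh hR r s) (heatKernel hh hR t r) x) := by
    rw [hcomp]
    exact integrable_heatKernelMeasure_of_bounded hh hR t x s hφm hφb
  have key := ProbabilityTheory.Kernel.integral_comp hint
  rw [hcomp] at key
  exact key

/-- **Bounded measurable data stays within its bounds**: if `a ≤ φ ≤ b` with `φ` measurable then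
`a ≤ ∫ φ dν_{x,t;s} ≤ b` (the heat kernel measures are probability measures). [folklore] -/
theorem integral_heatKernelMeasure_mem_Icc_of_bounded (t : ℝ) (x : M) (s : ℝ) {φ : M → ℝ}
    (hφm : Measurable φ) {a b : ℝ} (ha : ∀ y, a ≤ φ y) (hb : ∀ y, φ y ≤ b) :
    ∫ y, φ y ∂(heatKernelMeasure hh hR t x s) ∈ Icc a b := by
  set ν := heatKernelMeasure hh hR t x s
  have hφi : Integrable φ ν := by
    refine integrable_heatKernelMeasure_of_bounded hh hR t x s hφm (B := max |a| |b|) fun y ↦ ?_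
    rw [abs_le]
    constructor
    · have h1 : -|a| ≤ a := neg_abs_le a
      have h2 : |a| ≤ max |a| |b| := le_max_left _ _
      linarith [ha y]
    · exact (hb y).trans ((le_abs_self b).trans (le_max_right _ _))
  refine ⟨?_, ?_⟩
  · simpa [ν] using integral_mono (integrable_const a) hφi ha
  · simpa [ν] using integral_mono hφi (integrable_const b) hb

end MeasurableData

end Literature.Geometry.Riemannian

end
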